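import Literature.AlgebraicGeometry.Resolution.EmbeddedResolutionExcellentSurfacesSequence
import HarnessLib

/-!
# Sequences of `𝓑`-permissible blow-ups compose (Cossart–Jannsen–Saito 2020, (6.2) / Def. 6.8; Cor. 6.26)

Topic: `Literature/AlgebraicGeometry/Resolution`. The inductive predicates
`IsBPermissibleSequence X B σ X' B'` and `IsBPermissibleSequenceB X B σ X' B'` of
`EmbeddedResolutionExcellentSurfacesSequence.lean` (CJS LNM 2270, (6.2) with Def. 6.8: "a
sequence of complete `𝓑`-permissible blow-ups over `(X, Z)`"), and the tree's `IsEmbeddedTransform`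
(`EmbeddedResolution.lean`), are generated by APPENDING one blow-up to a sequence.  This file
PROVES that they are closed under CONCATENATION: a sequence over `(X, Z, B)` ending at
`(X', Z', B')` followed by a sequence over `(X', Z', B')` ending at `(X'', Z'', B'')` is a sequence
over `(X, Z, B)` ending at `(X'', Z'', B'')`, along the composite `Z'' ⟶ Z' ⟶ Z`.  This is the
(trivial, unstated) bookkeeping behind the source's iterations — Cor. 6.26, p. 89: "If not we
repeat the process, this time with `(X_1, 𝓑_1, O_1)`, and iterate if necessary" — and behind any
"run, stop, restart on the new stage" argument over these predicates.  Nothing is vendored.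

## Content (namespace `Literature.AlgebraicGeometry.Resolution`)

* `IsBPermissibleSequence.comp`, `IsBPermissibleSequenceB.comp` — concatenation;
* `IsBPermissibleSequence.comp_toB` — an Introduction-clause sequence followed by a Thm. 6.9 (a)-clause
  sequence is a Thm. 6.9 (a)-clause sequence;
* `IsEmbeddedTransform.comp` — the same for embedded transforms with centres over a fixed `T ⊆ X`
  (the second leg's centres must lie over `T` through the first composite).

## Sources

* V. Cossart, U. Jannsen, S. Saito, LNM 2270 (2020), (6.2) / Def. 6.8 (p. 82), Cor. 6.26 (p. 89)
  (text read: held copy, chunks p0082, p0089). [CossartJannsenSaito2020]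
* E. Bierstone, D. Grigoriev, P. Milman, J. Włodarczyk, *Effective Hironaka resolution and its
  complexity*, Asian J. Math. 15 (2011), Thm. 2.0.2 (1)–(2) (the source of `IsEmbeddedTransform`).
  [BierstoneGrigorievMilmanWlodarczyk2011]
-/

noncomputable section

open CategoryTheory AlgebraicGeometry TopologicalSpace

namespace Literature.AlgebraicGeometry.Resolution

universe u

open Scheme.IdealSheafData

/-- **Concatenation of sequences of complete `𝓑`-permissible blow-ups** (Introduction clause
`D_j ⊂ (X_j)_sing`): a sequence from `(X, Z, B)` to `(X', Z', B')` followed by one from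
`(X', Z', B')` to `(X'', Z'', B'')` is a sequence from `(X, Z, B)` to `(X'', Z'', B'')`.
[cite: CossartJannsenSaito2020, (6.2) / Def. 6.8 (p. 82); Cor. 6.26 (p. 89)] -/
theorem IsBPermissibleSequence.comp {Z : Scheme.{u}} {X B : Set Z} {Z' : Scheme.{u}} {σ : Z' ⟶ Z}
    {X' B' : Set Z'} (h₁ : IsBPermissibleSequence X B σ X' B') {Z'' : Scheme.{u}} {σ' : Z'' ⟶ Z'}
    {X'' B'' : Set Z''} (h₂ : IsBPermissibleSequence X' B' σ' X'' B'') :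
    IsBPermissibleSequence X B (σ' ≫ σ) X'' B'' := by
  induction h₂ with
  | refl => simpa using h₁
  | @blowup Z₁ Z₂ σ₁ X₁ B₁ h C τ hτ hreg hsub hsing hperm hnc ih =>
    have := IsBPermissibleSequence.blowup ih C τ hτ hreg hsub hsing hperm hnc
    simpa [Category.assoc] using this

/-- **Concatenation of sequences of complete `𝓑`-permissible blow-ups** (Thm. 6.9 (a) clause:
every centre point singular on `X_j` or on `B_j`).
[cite: CossartJannsenSaito2020, (6.2) / Def. 6.8 (p. 82); Cor. 6.26 (p. 89)] -/
theorem IsBPermissibleSequenceB.comp {Z : Scheme.{u}} {X B : Set Z} {Z' : Scheme.{u}} {σ : Z' ⟶ Z}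
    {X' B' : Set Z'} (h₁ : IsBPermissibleSequenceB X B σ X' B') {Z'' : Scheme.{u}} {σ' : Z'' ⟶ Z'}
    {X'' B'' : Set Z''} (h₂ : IsBPermissibleSequenceB X' B' σ' X'' B'') :
    IsBPermissibleSequenceB X B (σ' ≫ σ) X'' B'' := by
  induction h₂ with
  | refl => simpa using h₁
  | @blowup Z₁ Z₂ σ₁ X₁ B₁ h C τ hτ hreg hsub hBsing hperm hnc ih =>
    have := IsBPermissibleSequenceB.blowup ih C τ hτ hreg hsub hBsing hperm hnc
    simpa [Category.assoc] using this

/-- Mixed concatenation: an Introduction-clause sequence followed by a Thm. 6.9 (a)-clause sequence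
is a Thm. 6.9 (a)-clause sequence (`IsBPermissibleSequence.toB` on the first leg).
[cite: CossartJannsenSaito2020, Thm. 6.9 (a) (p. 83)] -/
theorem IsBPermissibleSequence.comp_toB {Z : Scheme.{u}} {X B : Set Z} {Z' : Scheme.{u}}
    {σ : Z' ⟶ Z} {X' B' : Set Z'} (h₁ : IsBPermissibleSequence X B σ X' B') {Z'' : Scheme.{u}}
    {σ' : Z'' ⟶ Z'} {X'' B'' : Set Z''} (h₂ : IsBPermissibleSequenceB X' B' σ' X'' B'') :
    IsBPermissibleSequenceB X B (σ' ≫ σ) X'' B'' :=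
  h₁.toB.comp h₂

/-- **Concatenation of embedded transforms** (`IsEmbeddedTransform`, regular centres over
`T ⊆ X`): a transform of `Y ⊆ X` along `σ : X' ⟶ X` followed by a transform of its strict
transform `Y'` along `σ' : X'' ⟶ X'` whose centres lie over `T` THROUGH `σ` (i.e. over
`σ ⁻¹' T`) is a transform of `Y` along `σ' ≫ σ` — the concatenation of two "finite sequences of
blowings-up" with centres over `T` in the sense of BGMW Thm. 2.0.2 (1)–(2), the source of the
predicate. [cite: BierstoneGrigorievMilmanWlodarczyk2011, Thm. 2.0.2 (1)–(2)] -/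
theorem IsEmbeddedTransform.comp {X : Scheme.{u}} {Y T : Set X} {X' : Scheme.{u}} {σ : X' ⟶ X}
    {Y' : Set X'} (h₁ : IsEmbeddedTransform Y T σ Y') {X'' : Scheme.{u}} {σ' : X'' ⟶ X'}
    {Y'' : Set X''} (h₂ : IsEmbeddedTransform Y' (σ ⁻¹' T) σ' Y'') :
    IsEmbeddedTransform Y T (σ' ≫ σ) Y'' := by
  induction h₂ with
  | refl => simpa using h₁
  | @blowup X₁ X₂ σ₁ Y₁ h C τ hτ hC hT ih =>
    have := IsEmbeddedTransform.blowup ih C τ hτ hC (by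
      rintro _ ⟨x, hx, rfl⟩
      have := hT ⟨x, hx, rfl⟩
      simpa [Scheme.Hom.comp_apply] using this)
    simpa [Category.assoc] using this

end Literature.AlgebraicGeometry.Resolution

end
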